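import Summits.Ventures.PercRepro.S1EightSixThreeSixFiveEight

/-!
# PercRepro — EVERY `1`-SEPARABLE `(8, 6)` CORE SATISFIES THE `(8, 4)` BODY (p2, gen 28; SUBCLAIM-S1 §6.10
(xvii)(p))

The `(8, 6)` capstone. A finite coloop-free matroid of rank `8` on `14` points with all pairs of rank `2` and a
proper separator `A`: both parts are coloop-free hence dependent and of rank `≥ 2`, the nullities add to `6` —
nullity `1` is a circuit of `M` (`rls_eight_four_of_circuit_separator`), otherwise the nullities are `(2, 4)`,
`(3, 3)` or `(4, 2)` and the rank `k ∈ {2, …, 6}` of `A` selects one of the eight consumers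
`S1EightSix{LineParts, FourPointLine, FiveThree, FourSevenTwice, FourSixFourEight, FiveNineThreeFive,
ThreeSixFiveEight}`. Nothing is claimed about any cell: the CONNECTED `(8, 6)` cores stay open.

* `rls_eight_four_of_corank_two_separator_six_{two, …, six}`, `rls_eight_four_of_corank_three_separator_six_{two, three, four}`;
* **`rls_eight_four_of_separator_six`** — the capstone at `(8, 6)`.
Axioms: standard.
-/

open scoped Matroid

namespace PercRepro

namespace S1

open Set

variable {α : Type}

section Shapes

variable (M : Matroid α) [M.Finite] {A : Set α} (hA : A ⊆ M.E) (hsep : M.eRk A + M.eRk (M.E \ A) = M.eRank)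
  (hpairs : ∀ e ∈ M.E, ∀ f ∈ M.E, e ≠ f → M.eRk {e, f} = 2) (hM : M.eRank = ((8 : ℕ) : ℕ∞))
  (hE : M.E.ncard = 14) (hcol : M.coloops = ∅)

include hA hsep hM hE hcol

/-- The common setup: the complement's rank, both ground sets, both coloop-freenesses, the pairs. -/
theorem separator_setup_six {k l : ℕ} (hkl : k + l = 8) (hrA : M.eRk A = (k : ℕ∞)) {a : ℕ} (hAa : A.ncard = a) :
    (M ↾ (M.E \ A)).eRank = (l : ℕ∞) ∧ (M ↾ (M.E \ A)).E.ncard = 14 - a ∧ (M ↾ A).eRank = (k : ℕ∞) ∧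
    (M ↾ A).E.ncard = a ∧ (M ↾ (M.E \ A)).coloops = ∅ ∧ (M ↾ A).coloops = ∅ := by
  have hB : M.E \ A ⊆ M.E := sdiff_subset
  have hsep' : M.eRk (M.E \ A) + M.eRk (M.E \ (M.E \ A)) = M.eRank := by
    rw [sdiff_sdiff_cancel_left hA, add_comm]; exact hsep
  refine ⟨?_, ?_, by rw [Matroid.eRank_restrict]; exact hrA, by rw [Matroid.restrict_ground_eq]; exact hAa,
    restrict_coloops_eq_empty_of_separator M hB hsep' hcol, restrict_coloops_eq_empty_of_separator M hA hsep hcol⟩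
  · have hM' : M.eRank = ((k + l : ℕ) : ℕ∞) := by rw [hM, hkl]
    exact restrict_compl_eRank_of_separator M hsep hrA hM'
  · rw [Matroid.restrict_ground_eq, ncard_sdiff' hA M.ground_finite, hE, hAa]

omit hM hE hcol in
/-- The bridge, for a consumer stated with the complement first. -/
theorem rls_of_consumer_compl_first (key : ∀ (P Q : Matroid α) [P.Finite] [Q.Finite] (h : Disjoint P.E Q.E),
      P = M ↾ (M.E \ A) → Q = M ↾ A →
      phiK 8 4 * ({X : Set α | X ⊆ (P.disjointSum Q h).E ∧ (P.disjointSum Q h).eRk X = ((8 : ℕ) : ℕ∞) ∧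
          (P.disjointSum Q h).eRk ((P.disjointSum Q h).E \ X) = ((4 : ℕ) : ℕ∞)}.ncard : ℚ) ≤
        ({X : Set α | X ⊆ (P.disjointSum Q h).E ∧ ((4 : ℕ) : ℕ∞) < (P.disjointSum Q h).eRk X ∧
          (P.disjointSum Q h).eRk X < ((8 : ℕ) : ℕ∞)}.ncard : ℚ)) : ThmN.RLS M 8 4 := by
  have hB : M.E \ A ⊆ M.E := sdiff_subset
  have hsep' : M.eRk (M.E \ A) + M.eRk (M.E \ (M.E \ A)) = M.eRank := by
    rw [sdiff_sdiff_cancel_left hA, add_comm]; exact hsep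
  have heq := eq_disjointSum_restrict_of_separator M hB hsep'
  haveI hBfin : (M ↾ (M.E \ A)).Finite := Matroid.restrict_finite (M.ground_finite.subset hB)
  haveI hAfin : (M ↾ A).Finite := Matroid.restrict_finite (M.ground_finite.subset hA)
  unfold ThmN.RLS
  rw [heq]
  have hAA : M.E \ (M.E \ A) = A := sdiff_sdiff_cancel_left hA
  have k := key (M ↾ (M.E \ A)) (M ↾ A) (by simp only [Matroid.restrict_ground_eq]; exact disjoint_sdiff_left) rfl rfl
  convert k using 3 <;> simp only [hAA]

end Shapes

/-- **THE CAPSTONE AT `(8, 6)`**: a finite coloop-free matroid of rank `8` on `14` points with all pairs of rank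
`2` that has a proper separator satisfies `ThmN.RLS M 8 4`. -/
theorem rls_eight_four_of_separator_six (M : Matroid α) [M.Finite] {A : Set α} (hA : A ⊆ M.E) (hne : A.Nonempty)
    (hne' : (M.E \ A).Nonempty) (hsep : M.eRk A + M.eRk (M.E \ A) = M.eRank)
    (hpairs : ∀ e ∈ M.E, ∀ f ∈ M.E, e ≠ f → M.eRk {e, f} = 2) (hM : M.eRank = ((8 : ℕ) : ℕ∞))
    (hE : M.E.ncard = 14) (hcol : M.coloops = ∅) : ThmN.RLS M 8 4 := by
  have hB : M.E \ A ⊆ M.E := sdiff_subset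
  have hAA : M.E \ (M.E \ A) = A := sdiff_sdiff_cancel_left hA
  have hsep' : M.eRk (M.E \ A) + M.eRk (M.E \ (M.E \ A)) = M.eRank := by
    rw [hAA, add_comm]; exact hsep
  have hne'' : (M.E \ (M.E \ A)).Nonempty := by rw [hAA]; exact hne
  have hfinA : M.eRk A ≠ ⊤ := ((M.eRk_le_encard _).trans_lt (M.ground_finite.subset hA).encard_lt_top).ne
  have hfinB : M.eRk (M.E \ A) ≠ ⊤ :=
    ((M.eRk_le_encard _).trans_lt (M.ground_finite.subset hB).encard_lt_top).ne
  obtain ⟨k, hk⟩ := ENat.ne_top_iff_exists.mp hfinA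
  obtain ⟨l, hl⟩ := ENat.ne_top_iff_exists.mp hfinB
  have hkA : M.eRk A = (k : ℕ∞) := hk.symm
  have hlB : M.eRk (M.E \ A) = (l : ℕ∞) := hl.symm
  have hkl : k + l = 8 := by
    have h := hsep
    rw [hkA, hlB, hM] at h
    exact_mod_cast h
  have hsize : A.ncard + (M.E \ A).ncard = 14 := by
    rw [ncard_sdiff' hA M.ground_finite, hE]
    have := ncard_le_ncard hA M.ground_finite
    rw [hE] at this
    omega
  have hdepA := eRk_add_one_le_ncard_of_separator M hA hsep hcol hne hkA
  have hdepB := eRk_add_one_le_ncard_of_separator M hB hsep' hcol hne' hlB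
  have hk2 := two_le_of_separator_part M hA hpairs hne' hkA hdepA
  have hl2 := two_le_of_separator_part M hB hpairs hne'' hlB hdepB
  -- the two circuit cases
  rcases Nat.lt_or_ge A.ncard (k + 2) with hcA | hcA
  · have hA1 : A.ncard = k + 1 := by omega
    have hC := isCircuit_of_separator_of_ncard_eq M hA hsep hcol hkA hA1
    have hsepC : M.eRk (M.E \ A) + M.eRk A = M.eRank := by rw [add_comm]; exact hsep
    exact rls_eight_four_of_circuit_separator M hC hsepC (by omega) hM hcol
  rcases Nat.lt_or_ge (M.E \ A).ncard (l + 2) with hcB | hcB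
  · have hB1 : (M.E \ A).ncard = l + 1 := by omega
    have hC := isCircuit_of_separator_of_ncard_eq M hB hsep' hcol hlB hB1
    have hsepC : M.eRk (M.E \ (M.E \ A)) + M.eRk (M.E \ A) = M.eRank := by rw [add_comm]; exact hsep'
    exact rls_eight_four_of_circuit_separator M hC hsepC (by omega) hM hcol
  -- the split cases: nullities `(2, 4)`, `(3, 3)`, `(4, 2)`; by symmetry take the part of nullity `2` or `3`
  -- as `A` (when `A` has nullity `4`, its complement has nullity `2`: swap the roles)
  have hk6 : k ≤ 6 := by omega
  have hnull : A.ncard = k + 2 ∨ A.ncard = k + 3 ∨ A.ncard = k + 4 := by omega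
  -- the generic applications, for `A` with nullity `2` (`c2`) and nullity `3` (`c3`), by the rank `k`
  have c2 : ∀ (X : Set α) (hX : X ⊆ M.E) (hsepX : M.eRk X + M.eRk (M.E \ X) = M.eRank) (k : ℕ),
      2 ≤ k → k ≤ 6 → M.eRk X = (k : ℕ∞) → X.ncard = k + 2 → ThmN.RLS M 8 4 := by
    intro X hX hsepX k hk2 hk6 hrX hXc
    obtain ⟨hrB, hBE, hrA', hAE', hcolB, hcolA⟩ := separator_setup_six M hX hsepX hM hE hcol
      (l := 8 - k) (by omega) hrX hXc
    have hpB := restrict_pairs_of_pairs M hpairs (sdiff_subset : M.E \ X ⊆ M.E)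
    have hpA := restrict_pairs_of_pairs M hpairs hX
    apply rls_of_consumer_compl_first M hX hsepX
    intro P Q _ _ h hP hQ
    subst hP hQ
    interval_cases k
    · -- `U_{2,4}` ⊕ rank `6` on `10`
      exact c025_eight_four_disjointSum_rank_six_ten_line_four _ _ h hrB (by omega) hcolB hrA' hAE' hpA
    · exact c025_eight_four_disjointSum_five_nine_three_five _ _ h hrB (by omega) hcolB hpB hrA' hAE' hcolA hpA
    · have key := c025_eight_four_disjointSum_four_six_four_eight _ _ (h.symm) hrA' hAE' hcolA hpA hrB (by omega)
        hcolB hpB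
      rw [Matroid.disjointSum_comm] at key
      exact key
    · have key := c025_eight_four_disjointSum_five_seven_three_seven _ _ (h.symm) hrA' hAE' hcolA hpA hrB
        (by omega) hcolB hpB
      rw [Matroid.disjointSum_comm] at key
      exact key
    · have key := c025_eight_four_disjointSum_rank_six_eight_line_six _ _ (h.symm) hrA' hAE' hrB (by omega) hpB
      rw [Matroid.disjointSum_comm] at key
      exact key
  have c3 : ∀ (X : Set α) (hX : X ⊆ M.E) (hsepX : M.eRk X + M.eRk (M.E \ X) = M.eRank) (k : ℕ),
      2 ≤ k → k ≤ 6 → M.eRk X = (k : ℕ∞) → X.ncard = k + 3 → ThmN.RLS M 8 4 := by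
    intro X hX hsepX k hk2 hk6 hrX hXc
    obtain ⟨hrB, hBE, hrA', hAE', hcolB, hcolA⟩ := separator_setup_six M hX hsepX hM hE hcol
      (l := 8 - k) (by omega) hrX hXc
    have hpB := restrict_pairs_of_pairs M hpairs (sdiff_subset : M.E \ X ⊆ M.E)
    have hpA := restrict_pairs_of_pairs M hpairs hX
    apply rls_of_consumer_compl_first M hX hsepX
    intro P Q _ _ h hP hQ
    subst hP hQ
    interval_cases k
    · -- `U_{2,5}` ⊕ rank `6` on `9`
      have key := c025_eight_four_disjointSum_line_five_rank_six_nine _ _ (h.symm) hrA' hAE' hpA hrB (by omega)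
      rw [Matroid.disjointSum_comm] at key
      exact key
    · have key := c025_eight_four_disjointSum_three_six_five_eight _ _ (h.symm) hrA' hAE' hcolA hpA hrB (by omega)
        hcolB hpB
      rw [Matroid.disjointSum_comm] at key
      exact key
    · exact c025_eight_four_disjointSum_four_seven_twice _ _ h hrB (by omega) hcolB hpB hrA' hAE' hcolA hpA
    · exact c025_eight_four_disjointSum_three_six_five_eight _ _ h hrB (by omega) hcolB hpB hrA' hAE' hcolA hpA
    · exact c025_eight_four_disjointSum_line_five_rank_six_nine _ _ h hrB (by omega) hpB hrA' hAE'
  rcases hnull with h2 | h3 | h4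
  · exact c2 A hA hsep k hk2 hk6 hkA h2
  · exact c3 A hA hsep k hk2 hk6 hkA h3
  · -- the complement has nullity `2`
    exact c2 (M.E \ A) hB hsep' l hl2 (by omega) hlB (by omega)

end S1

end PercRepro
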